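import Literature.AlgebraicGeometry.Hu2025.Statements.S01S09Interface.R110eGammaOfMatroid
import Literature.AlgebraicGeometry.Hu2025.Proofs.S01S09Interface.Prop91Ours
import Mathlib.Data.Finset.Sort
import HarnessLib

/-!
# `C72L129` for OCCURRING strata — row 110 file e's unnumbered claim «Since Δ_d ≠ ∅, there exists m with x_m ∈ Δ_d» holds
# whenever d is realised (`C72L129_of_isRealisable`), via `exists_vertexMem_of_isRealisable` and the sort-and-shift
# transport `exists_plIndex_tripleSet_eq` (3-subsets of Fin n ↔ 𝕀_{3,n}). res-type-024 gen 11; kernel support, nothing of [Hu25] asserted.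
-/

namespace Literature.AlgebraicGeometry.Hu2025.Statements.S01S09Interface

open Literature.AlgebraicGeometry.Hu2025.Statements.S03Pluecker

/-- Every 3-subset `u ⊆ Fin n` is `tripleSet n m` for an increasing triple `m ∈ 𝕀_{3,n}` (sort `u` and shift by one).
[cite: Hu2025, (9.1)/(9.2) chunk p0072 l.42–50, l.126–135 (unrefereed preprint arXiv:2507.21400v1 under adjudication,
D-0012/D-0089 — kernel support on OUR typed carriers `tripleSet` (row 110) / `plIndexSet` (row 101); nothing of the source
asserted)] -/
theorem exists_plIndex_tripleSet_eq {n : ℕ} (u : Finset (Fin n)) (hu : u.card = 3) :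
    ∃ m : plIndex n, tripleSet n m.1 = u := by
  classical
  let f := u.orderEmbOfFin hu
  have h01 : f 0 < f 1 := f.strictMono (by decide)
  have h12 : f 1 < f 2 := f.strictMono (by decide)
  have hmem : ((f 0).val + 1, (f 1).val + 1, (f 2).val + 1) ∈ plIndexSet n := by
    simp only [plIndexSet, Finset.mem_filter, Finset.mem_product, Finset.mem_Icc]
    refine ⟨⟨⟨by omega, by omega⟩, ⟨by omega, by omega⟩, ⟨by omega, by omega⟩⟩, ?_, ?_⟩
    · exact Nat.succ_lt_succ h01
    · exact Nat.succ_lt_succ h12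
  refine ⟨⟨_, hmem⟩, ?_⟩
  ext i
  simp only [tripleSet, Finset.mem_filter, Finset.mem_univ, true_and, Finset.mem_insert, Finset.mem_singleton,
    Nat.succ_inj]
  constructor
  · rintro (h | h | h)
    · have : i = f 0 := Fin.ext h
      rw [this]; exact Finset.orderEmbOfFin_mem u hu 0
    · have : i = f 1 := Fin.ext h
      rw [this]; exact Finset.orderEmbOfFin_mem u hu 1
    · have : i = f 2 := Fin.ext h
      rw [this]; exact Finset.orderEmbOfFin_mem u hu 2
  · intro hi
    have : i ∈ Set.range f := by rw [Finset.range_orderEmbOfFin]; exact hi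
    obtain ⟨j, hj⟩ := this
    fin_cases j
    · exact Or.inl (by rw [← hj]; rfl)
    · exact Or.inr (Or.inl (by rw [← hj]; rfl))
    · exact Or.inr (Or.inr (by rw [← hj]; rfl))

/-- **`C72L129` HOLDS for every OCCURRING stratum** (independently of the printed real-polytope hypothesis `Δ_d ≠ ∅`): if `d`
is realised, some `m ∈ 𝕀_{3,n}` has `x_m ∈ Δ^{3,n}_d` — `exists_vertexMem_of_isRealisable` (file `Prop91Ours`) transported
to row 101's index type. [cite: Hu2025, §9 chunk p0072 l.128–130 (unrefereed preprint arXiv:2507.21400v1 under adjudication,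
D-0012/D-0089 — kernel support on OUR typed reading `C72L129`; nothing of the source asserted)] -/
theorem C72L129_of_isRealisable {n : ℕ} (M : HuMatroid n 3) (h : M.IsRealisable) : C72L129 M := by
  intro _
  obtain ⟨u, hu⟩ := exists_vertexMem_of_isRealisable M h
  obtain ⟨m, hm⟩ := exists_plIndex_tripleSet_eq u hu.1
  exact ⟨m, hm ▸ hu⟩

end Literature.AlgebraicGeometry.Hu2025.Statements.S01S09Interface
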